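import Literature.Analysis.FluidPDE.PassiveVectorGalerkinLimit
import HarnessLib

/-!
# The Fourier–Galerkin scheme for the passive solenoidal vector: the mode equations of the approximations

Analysis/FluidPDE proof-support file (theorems only; no definitions, no named facts), supplement to
`PassiveVectorGalerkinLimit`. When all carrier modes are resolved (`B ⊆ freqBall N`) the truncated carrier coefficients
extend by zero to the full carrier family (`coeffExt_carrierTrunc_eq`), and every extended Fourier mode
`t ↦ α_N(t)(k)` of the Galerkin approximation is differentiable within `[0, T]` with derivative the `k`-th component of
the Galerkin field `Torus.pvGalerkinField κ (freqBall N) (β t) (α_N t)` (`PVSetup.hasDerivWithinAt_galerkinCoeffAt`;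
Robinson–Rodrigo–Sadowski 2016, (4.5), mode by mode) — the form in which the ladder identities of
`PassiveVectorLayerLadder` are applied along solutions.

## References

* J. C. Robinson, J. L. Rodrigo, W. Sadowski, *The three-dimensional Navier–Stokes equations* (CUP 2016),
  Thm. 4.4 Step 1, (4.5). [`RobinsonRodrigoSadowski2016`]
-/

open MeasureTheory Set Filter Topology UnitAddTorus Function
open scoped InnerProductSpace

noncomputable section

namespace Literature.Analysis.FluidPDE

namespace Torus

open FunctionSpaces.Torus FunctionSpaces

variable {d : Type*} [Fintype d] [DecidableEq d]

variable {b : ℝ → UnitAddTorus d → EuclideanSpace ℝ d} {B : Finset (d → ℤ)}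
  {β : ℝ → (d → ℤ) → EuclideanSpace ℂ d} {C κ : ℝ} {Sec : Set (d → ℤ)}
  {w₀ : UnitAddTorus d → EuclideanSpace ℝ d}

/-- **All carrier modes resolved**: for `B ⊆ freqBall N` the truncated carrier coefficients, extended by zero, are the
carrier coefficients. [cite: RobinsonRodrigoSadowski2016, Thm. 4.4 Step 1 (4.5)] -/
theorem coeffExt_carrierTrunc_eq (hc : TrigPolyCarrier b B β C) {N : ℕ} (hBN : B ⊆ freqBall N) (t : ℝ) :
    coeffExt (freqBall N) (carrierTrunc β N t) = β t := by
  funext l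
  by_cases hl : l ∈ freqBall N
  · rw [coeffExt_of_mem _ hl]; rfl
  · rw [coeffExt_of_not_mem _ hl]
    exact (hc.support t l fun hlB => hl (hBN hlB)).symm

omit [DecidableEq d] in
/-- The extended coefficient family is the extension by zero of the coefficient vector. [cite: RobinsonRodrigoSadowski2016, Thm. 4.4 Step 1 (4.3)] -/
theorem PVSetup.coeffExt_galerkinCoeff [DecidableEq d] (h : PVSetup κ b B β C Sec w₀) (N : ℕ) (t : ℝ) :
    coeffExt (freqBall N) (h.galerkinCoeff N t) = h.galerkinCoeffAt N t := rfl

/-- **The mode equations of the Galerkin approximation**: for `B ⊆ freqBall N`, `k ∈ freqBall N` and `t ∈ [0, T]`,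
`d/dt α_N(t)(k) = (pvGalerkinField κ (freqBall N) (β t) (α_N t))_k` within `[0, T]`. [cite: RobinsonRodrigoSadowski2016, Thm. 4.4 Step 1 (4.5)] -/
theorem PVSetup.hasDerivWithinAt_galerkinCoeffAt (h : PVSetup κ b B β C Sec w₀) {N : ℕ} (hBN : B ⊆ freqBall N)
    {k : d → ℤ} (hk : k ∈ freqBall N) {T t : ℝ} (ht : t ∈ Icc 0 T) :
    HasDerivWithinAt (fun τ => h.galerkinCoeffAt N τ k)
      (pvGalerkinField κ (freqBall N) (β t) (h.galerkinCoeffAt N t) k) (Icc 0 T) t := by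
  have h1 := (h.galerkinCoeff_spec N).2.2.2.1 T t ht
  have h2 := (ContinuousLinearMap.proj (R := ℝ) (φ := fun _ : ↥(freqBall (d := d) N) => EuclideanSpace ℂ d) ⟨k, hk⟩).hasFDerivAt
    |>.comp_hasDerivWithinAt t h1
  have e1 : (fun τ => h.galerkinCoeffAt N τ k) = fun τ => h.galerkinCoeff N τ ⟨k, hk⟩ := by
    funext τ; rw [PVSetup.galerkinCoeffAt, coeffExt_of_mem _ hk]
  rw [e1]
  refine h2.congr_deriv ?_
  rw [ContinuousLinearMap.proj_apply, pvGalerkinRHS_apply, coeffExt_carrierTrunc_eq h.carrier hBN t,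
    h.coeffExt_galerkinCoeff N t]

/-- Off the Galerkin ball the extended modes are identically zero (hence trivially differentiable). [cite: RobinsonRodrigoSadowski2016, Thm. 4.4 Step 1 (4.3)] -/
theorem PVSetup.hasDerivWithinAt_galerkinCoeffAt_of_not_mem (h : PVSetup κ b B β C Sec w₀) {N : ℕ} {k : d → ℤ}
    (hk : k ∉ freqBall N) (s : Set ℝ) (t : ℝ) :
    HasDerivWithinAt (fun τ => h.galerkinCoeffAt N τ k) 0 s t := by
  have e1 : (fun τ => h.galerkinCoeffAt N τ k) = fun _ => 0 := by
    funext τ; rw [PVSetup.galerkinCoeffAt, coeffExt_of_not_mem _ hk]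
  rw [e1]
  exact hasDerivWithinAt_const _ _ _

/-- **Scalar components of the mode equations**: for a fixed `ζ ∈ ℂ^d`,
`d/dt ⟪ζ, α_N(t)(k)⟫ = ⟪ζ, (pvGalerkinField κ (freqBall N) (β t) (α_N t))_k⟫` within `[0, T]`. [cite: RobinsonRodrigoSadowski2016, Thm. 4.4 Step 1 (4.5)] -/
theorem PVSetup.hasDerivWithinAt_inner_galerkinCoeffAt (h : PVSetup κ b B β C Sec w₀) {N : ℕ} (hBN : B ⊆ freqBall N)
    {k : d → ℤ} (hk : k ∈ freqBall N) {T t : ℝ} (ht : t ∈ Icc 0 T) (ζ : EuclideanSpace ℂ d) :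
    HasDerivWithinAt (fun τ => inner ℂ ζ (h.galerkinCoeffAt N τ k))
      (inner ℂ ζ (pvGalerkinField κ (freqBall N) (β t) (h.galerkinCoeffAt N t) k)) (Icc 0 T) t := by
  have h1 := h.hasDerivWithinAt_galerkinCoeffAt hBN hk ht
  have h2 := (hasDerivWithinAt_const t (Icc 0 T) ζ).inner ℂ h1
  simpa using h2

end Torus

end Literature.Analysis.FluidPDE
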